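import Literature.AlgebraicGeometry.Frobenioids.GeometricFrobenioidsThm62ivSchemaNegative
import Mathlib.RingTheory.Polynomial.Eisenstein.Criterion
import Mathlib.RingTheory.Polynomial.GaussLemma
import Mathlib.RingTheory.Polynomial.RationalRoot
import Mathlib.Data.Nat.Prime.Int
import Mathlib.RingTheory.AdjoinRoot
import Mathlib.FieldTheory.Normal.Basic
import Mathlib.FieldTheory.Galois.Basic
import Mathlib.Analysis.Real.Sqrt
import HarnessLib

/-!
# Frobenioids I, Theorem 6.2 (iv) AS TYPED (`Thm62iv`, F-1105): the bare field datum at `ℚ(⁴√2)/ℚ`,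
# and the universal closure refuted UNCONDITIONALLY (PROOF-ONLY)

Mochizuki, *The geometry of Frobenioids I: the general theory*, Kyushu J. Math. **62** (2008) 293–400, Example 6.1
p. 109, Theorem 6.2 (iv) p. 111, Def. 4.5 (iv) p. 86. [cite: MochizukiFrdI2008, Thm. 6.2 (iv) p.111]
[cite: MochizukiFrdI2008, Ex. 6.1 p.109]

PROOF-ONLY sequel of `GeometricFrobenioidsThm62ivSchema.lean` / `…SchemaNegative.lean` (abc-iut cell, block F, seat
abc-iut-f-045 gen 6; FROZEN FACT-LIST row F-1105).  No `def`, no `instance`, no new named fact; pure Mathlib field theory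
(PRIVATE helpers `Thm62ivFieldDatum.*`, elementary Galois theory, no source claimed) plus one application of the tree
theorem `not_forall_thm62iv_of_field`.

WHAT IS RECORDED.
* `Thm62ivFieldDatum.le_of_normal_of_not_normal` — generic: in a finite NON-normal extension `Kt/K` with an intermediate
  field `L`, normal over `K`, of index `[Kt : L] = 2`, every intermediate field normal over `K` lies in `L` (the compositum
  with `L` is normal of degree a multiple of `[L : K]` dividing `2·[L : K]`, and is not `Kt`).
* `Thm62ivFieldDatum.trivial_on_galois_of_fixes_quadratic` — generic: if moreover `[Kt : K] = 4` and `a ∈ Kt` is a root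
  of an irreducible monic quadratic, a `K`-automorphism fixing `a` fixes pointwise every intermediate field Galois over `K`.
* `Thm62ivFieldDatum.irreducible_X_pow_sub_two` — `X ^ n - 2 ∈ ℚ[X]` is irreducible (`n ≠ 0`; Eisenstein at `2` over `ℤ`,
  Gauss's lemma); `Thm62ivFieldDatum.not_splits_X_pow_four_sub_two_real` — `X ^ 4 - 2` does not split over `ℝ`
  (`X ^ 2 + √2 ∣ X ^ 4 - 2` has no real root); hence `ℚ(⁴√2) := ℚ[X]/(X ^ 4 - 2)` has degree `4` and is NOT normal over
  `ℚ` (real embedding `⁴√2 ↦ √√2`).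
* `thm62iv_field_datum` — **the datum H_F1105' INHABITED**: `K := ℚ`, `Kt := ℚ(⁴√2)`, `z : ⁴√2 ↦ −⁴√2` (an involution,
  `≠ 1` as `⁴√2 ≠ 0`), `a := √2 = (⁴√2)²` with `z a = a`; every intermediate field Galois over `ℚ` lies in `ℚ(√2)`.
* `not_forall_thm62iv` — **F-1105 (`Thm62iv`): the universal closure over the typed binders (no `[IsGalois K Kt]`) is
  REFUTED UNCONDITIONALLY**, `:= not_forall_thm62iv_of_field thm62iv_field_datum` (the refuting model is the constructed
  `geomModelFrobenioid Γ` of the embedding divisor data over `ℚ(⁴√2)/ℚ`, see `…SchemaNegative.lean`).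
HONEST FRAMING: bookkeeping about the typing only.  Print's Thm. 6.2 (iv) carries the standing hypothesis of Ex. 6.1 that
`K̃/K` is Galois and is PROVED in the tree at that strength (`Thm62iv_holds`, p408988); `ℚ(⁴√2)/ℚ` is not Galois, so
nothing here contradicts print.  Nothing here bears on [IUTchIII] Cor. 3.12; no side taken; typed ≠ proved;
refuted-as-typed ≠ refuted-in-print.
-/

noncomputable section

namespace Literature.AlgebraicGeometry.Frobenioids

open CategoryTheory Polynomial
open scoped IntermediateField

namespace Thm62ivFieldDatum

/-! ### Generic field theory: normal subextensions of a non-normal extension of index `2` over a normal one -/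

/-- A quadratic extension of fields is normal (Mathlib: `Algebra.IsQuadraticExtension.normal`). [folklore] -/
private theorem normal_of_finrank_eq_two {K L : Type*} [Field K] [Field L] [Algebra K L]
    (h : Module.finrank K L = 2) : Normal K L :=
  haveI : Algebra.IsQuadraticExtension K L := { finrank_eq_two' := h }
  inferInstance

/-- If `Kt/K` is finite and NOT normal, and `L ⊆ Kt` is an intermediate field, normal over `K`, with
`[Kt : K] = [L : K]·2`, then every intermediate field `E ⊆ Kt` normal over `K` lies in `L`: the compositum `E·L` is
normal over `K` of degree a multiple of `[L : K]` dividing `[L : K]·2`, and it is not all of `Kt`. [folklore] -/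
private theorem le_of_normal_of_not_normal {K Kt : Type*} [Field K] [Field Kt] [Algebra K Kt]
    [FiniteDimensional K Kt] (hKt : ¬ Normal K Kt) (L : IntermediateField K Kt) [Normal K L]
    (hL : Module.finrank K Kt = Module.finrank K L * 2) (E : IntermediateField K Kt) [Normal K E] :
    E ≤ L := by
  haveI hMn : Normal K (E ⊔ L : IntermediateField K Kt) := inferInstance
  have hLM : L ≤ E ⊔ L := le_sup_right
  have h1 : Module.finrank K L ∣ Module.finrank K (E ⊔ L : IntermediateField K Kt) :=
    IntermediateField.finrank_dvd_of_le_right hLM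
  have h2 : Module.finrank K (E ⊔ L : IntermediateField K Kt) ∣ Module.finrank K Kt := by
    rw [← IntermediateField.finrank_top' (F := K) (E := Kt)]
    exact IntermediateField.finrank_dvd_of_le_right le_top
  have hne : Module.finrank K (E ⊔ L : IntermediateField K Kt) ≠ Module.finrank K Kt := by
    intro h
    have hMeq : (E ⊔ L : IntermediateField K Kt) = ⊤ :=
      IntermediateField.eq_of_le_of_finrank_eq le_top (by rw [h, IntermediateField.finrank_top'])
    have hT : Normal K (⊤ : IntermediateField K Kt) := by rw [← hMeq]; exact hMn
    exact hKt (Normal.of_algEquiv (IntermediateField.topEquiv (F := K) (E := Kt)))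
  -- arithmetic: `[L:K] ∣ m ∣ [L:K]·2` and `m ≠ [L:K]·2` force `m = [L:K]`
  have hpos : 0 < Module.finrank K L := Module.finrank_pos
  obtain ⟨k, hk⟩ := h1
  have hk2 : k ∣ 2 := by
    have h' : Module.finrank K L * k ∣ Module.finrank K L * 2 := by rw [← hk, ← hL]; exact h2
    exact Nat.dvd_of_mul_dvd_mul_left hpos h'
  have hk1 : k = 1 := by
    rcases (Nat.dvd_prime Nat.prime_two).1 hk2 with h | h
    · exact h
    · exact absurd (by rw [hk, h, hL]) hne
  have hLeq : L = E ⊔ L := IntermediateField.eq_of_le_of_finrank_eq hLM (by rw [hk, hk1, mul_one])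
  exact le_sup_left.trans hLeq.symm.le

/-- **Generic form of the field datum.**  Let `Kt/K` be finite of degree `4` and NOT normal, `a ∈ Kt` a root of a monic
irreducible quadratic `p ∈ K[X]`, and `z` a `K`-automorphism of `Kt` with `z a = a`.  Then `z` fixes pointwise every
intermediate field Galois over `K`: all of them lie in `K(a)` (normal, of index `2`), which `z` fixes pointwise.
[folklore] -/
private theorem trivial_on_galois_of_fixes_quadratic {K Kt : Type*} [Field K] [Field Kt] [Algebra K Kt]
    [FiniteDimensional K Kt] (hKt : ¬ Normal K Kt) (h4 : Module.finrank K Kt = 4)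
    {p : K[X]} (hp : Irreducible p) (hpm : p.Monic) (hp2 : p.natDegree = 2)
    {a : Kt} (hpa : aeval a p = 0) (z : Kt ≃ₐ[K] Kt) (hza : z a = a)
    (E : IntermediateField K Kt) [IsGalois K E] (x : Kt) (hx : x ∈ E) : z x = x := by
  -- `[K(a) : K] = 2`, so `K(a)/K` is normal
  have hmin : minpoly K a = p := (minpoly.eq_of_irreducible_of_monic hp hpa hpm).symm
  have hLa : Module.finrank K K⟮a⟯ = 2 := by
    rw [IntermediateField.adjoin.finrank (Algebra.IsIntegral.isIntegral a), hmin, hp2]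
  haveI : Normal K K⟮a⟯ := normal_of_finrank_eq_two hLa
  -- `E ⊆ K(a)`
  have hE : E ≤ K⟮a⟯ := le_of_normal_of_not_normal hKt K⟮a⟯ (by rw [h4, hLa]) E
  -- `z` fixes `K(a)` pointwise
  refine IntermediateField.adjoin_induction (F := K) (p := fun y _ => z y = y) ?_ ?_ ?_ ?_ ?_ (hE hx)
  · rintro y rfl; exact hza
  · intro q; exact z.commutes q
  · intro b c _ _ hb hc; rw [map_add, hb, hc]
  · intro b _ hb; rw [map_inv₀, hb]
  · intro b c _ _ hb hc; rw [map_mul, hb, hc]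

/-! ### `X ^ n - 2` is irreducible over `ℚ`; `X ^ 4 - 2` does not split over `ℝ` -/

/-- `X ^ n - 2 ∈ ℤ[X]` is irreducible for `n ≠ 0`: Eisenstein's criterion at the prime `2`. [folklore] -/
private theorem irreducible_X_pow_sub_two_int {n : ℕ} (hn : n ≠ 0) :
    Irreducible (X ^ n - C (2 : ℤ) : ℤ[X]) := by
  set P : Ideal ℤ := Ideal.span {(2 : ℤ)} with hPdef
  have hP : P.IsPrime := (Ideal.span_singleton_prime (by norm_num)).mpr Int.prime_two
  have hmon : (X ^ n - C (2 : ℤ) : ℤ[X]).Monic := monic_X_pow_sub_C (2 : ℤ) hn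
  have hdeg : (X ^ n - C (2 : ℤ) : ℤ[X]).degree = n := degree_X_pow_sub_C (Nat.pos_of_ne_zero hn) 2
  refine irreducible_of_eisenstein_criterion hP ?_ ?_ ?_ ?_ hmon.isPrimitive
  · rw [hmon.leadingCoeff]
    exact fun h1 => hP.ne_top ((Ideal.eq_top_iff_one P).2 h1)
  · intro j hj
    rw [hdeg] at hj
    have hj' : j < n := by exact_mod_cast hj
    rw [coeff_sub, coeff_X_pow, if_neg hj'.ne, zero_sub, coeff_C]
    split_ifs
    · exact P.neg_mem (Ideal.mem_span_singleton_self 2)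
    · rw [neg_zero]; exact P.zero_mem
  · rw [hdeg]; exact_mod_cast Nat.pos_of_ne_zero hn
  · rw [coeff_sub, coeff_X_pow, if_neg (fun h => hn h.symm), zero_sub, coeff_C_zero, hPdef,
      Ideal.span_singleton_pow, Ideal.mem_span_singleton]
    norm_num

/-- `X ^ n - 2 ∈ ℚ[X]` is irreducible for `n ≠ 0`: Eisenstein at `2` over `ℤ` and Gauss's lemma
(`Polynomial.Monic.irreducible_iff_irreducible_map_fraction_map`). [folklore] -/
private theorem irreducible_X_pow_sub_two {n : ℕ} (hn : n ≠ 0) :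
    Irreducible (X ^ n - C (2 : ℚ) : ℚ[X]) := by
  have hmon : (X ^ n - C (2 : ℤ) : ℤ[X]).Monic := monic_X_pow_sub_C (2 : ℤ) hn
  have h := (hmon.irreducible_iff_irreducible_map_fraction_map (K := ℚ)).1
    (irreducible_X_pow_sub_two_int hn)
  rw [Polynomial.map_sub, Polynomial.map_pow, map_X, map_C, eq_intCast, Int.cast_ofNat] at h
  exact h

/-- `X ^ 4 - 2` does not split over `ℝ`: its factor `X ^ 2 + √2` has no real root. [folklore] -/
private theorem not_splits_X_pow_four_sub_two_real : ¬ (X ^ 4 - C (2 : ℝ) : ℝ[X]).Splits := by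
  intro h
  set s : ℝ := Real.sqrt 2 with hs
  have hs2 : s ^ 2 = 2 := Real.sq_sqrt (by norm_num)
  have hfac : (X ^ 4 - C (2 : ℝ) : ℝ[X]) = (X ^ 2 - C s) * (X ^ 2 + C s) := by
    have : (C (2 : ℝ) : ℝ[X]) = C s * C s := by rw [← C_mul, ← sq, hs2]
    rw [this]; ring
  have hne : (X ^ 4 - C (2 : ℝ) : ℝ[X]) ≠ 0 := (monic_X_pow_sub_C (2 : ℝ) four_ne_zero).ne_zero
  have hdvd : (X ^ 2 + C s : ℝ[X]) ∣ (X ^ 4 - C (2 : ℝ)) := ⟨X ^ 2 - C s, by rw [hfac, mul_comm]⟩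
  have h2 : (X ^ 2 + C s : ℝ[X]).Splits := h.of_dvd hne hdvd
  have hdeg : (X ^ 2 + C s : ℝ[X]).degree ≠ 0 := by
    rw [degree_X_pow_add_C two_pos]; exact two_ne_zero
  obtain ⟨x, hx⟩ := h2.exists_eval_eq_zero hdeg
  rw [eval_add, eval_pow, eval_X, eval_C] at hx
  have hs0 : 0 < s := Real.sqrt_pos.mpr two_pos
  nlinarith [sq_nonneg x]

/-! ### The field `ℚ(⁴√2) := ℚ[X]/(X ^ 4 - 2)` (`AdjoinRoot`, a field once `X ^ 4 - 2` is known irreducible) -/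

section Quartic

variable [hirr : Fact (Irreducible (X ^ 4 - C (2 : ℚ) : ℚ[X]))]

omit hirr in
/-- `X ^ 4 - 2 ≠ 0` in `ℚ[X]`. [folklore] -/
private theorem quartic_ne_zero : (X ^ 4 - C (2 : ℚ) : ℚ[X]) ≠ 0 :=
  (monic_X_pow_sub_C (2 : ℚ) four_ne_zero).ne_zero

/-- `ℚ(⁴√2)` is finite-dimensional over `ℚ` (power basis of `AdjoinRoot`). [folklore] -/
private theorem finiteDimensional_quartic : FiniteDimensional ℚ (AdjoinRoot (X ^ 4 - C (2 : ℚ) : ℚ[X])) :=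
  (AdjoinRoot.powerBasis quartic_ne_zero).finite

/-- `[ℚ(⁴√2) : ℚ] = 4`. [folklore] -/
private theorem finrank_quartic : Module.finrank ℚ (AdjoinRoot (X ^ 4 - C (2 : ℚ) : ℚ[X])) = 4 := by
  rw [(AdjoinRoot.powerBasis quartic_ne_zero).finrank, AdjoinRoot.powerBasis_dim,
    natDegree_X_pow_sub_C]

/-- `(⁴√2) ^ 4 = 2` in `ℚ(⁴√2)`. [folklore] -/
private theorem root_pow_four : (AdjoinRoot.root (X ^ 4 - C (2 : ℚ) : ℚ[X])) ^ 4 = 2 := by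
  have h := AdjoinRoot.eval₂_root (X ^ 4 - C (2 : ℚ) : ℚ[X])
  rw [eval₂_sub, eval₂_X_pow, eval₂_C, sub_eq_zero] at h
  exact h.trans (map_ofNat _ 2)

/-- `⁴√2` is a root of `X ^ 4 - 2` (for ANY `ℚ`-algebra structure on `ℚ(⁴√2)`: `algebraMap ℚ _ 2 = 2`). [folklore] -/
private theorem aeval_root_quartic :
    aeval (AdjoinRoot.root (X ^ 4 - C (2 : ℚ) : ℚ[X])) (X ^ 4 - C (2 : ℚ) : ℚ[X]) = 0 := by
  rw [map_sub, map_pow, aeval_X, aeval_C, root_pow_four, sub_eq_zero]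
  exact (map_ofNat _ 2).symm

/-- The minimal polynomial of `⁴√2` over `ℚ` is `X ^ 4 - 2`. [folklore] -/
private theorem minpoly_root_quartic :
    minpoly ℚ (AdjoinRoot.root (X ^ 4 - C (2 : ℚ) : ℚ[X])) = X ^ 4 - C (2 : ℚ) :=
  (minpoly.eq_of_irreducible_of_monic hirr.out aeval_root_quartic
    (monic_X_pow_sub_C (2 : ℚ) four_ne_zero)).symm

/-- `ℚ(⁴√2)/ℚ` is NOT normal: otherwise `X ^ 4 - 2 = minpoly ⁴√2` would split in `ℚ(⁴√2)`, hence in `ℝ` along the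
real embedding `⁴√2 ↦ √√2`. [folklore] -/
private theorem not_normal_quartic : ¬ Normal ℚ (AdjoinRoot (X ^ 4 - C (2 : ℚ) : ℚ[X])) := by
  intro hN
  set f : ℚ[X] := X ^ 4 - C (2 : ℚ) with hf
  -- the real embedding `⁴√2 ↦ √√2`
  set r : ℝ := Real.sqrt (Real.sqrt 2) with hr
  have hr4 : r ^ 4 = 2 := by
    have h2 : r ^ 2 = Real.sqrt 2 := Real.sq_sqrt (Real.sqrt_nonneg 2)
    calc r ^ 4 = (r ^ 2) ^ 2 := by ring
      _ = 2 := by rw [h2, Real.sq_sqrt (by norm_num)]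
  have hev : f.eval₂ (algebraMap ℚ ℝ) r = 0 := by
    rw [hf, eval₂_sub, eval₂_X_pow, eval₂_C, hr4, eq_ratCast, Rat.cast_ofNat, sub_self]
  let φ : AdjoinRoot f →ₐ[ℚ] ℝ := AdjoinRoot.liftAlgHom f (Algebra.ofId ℚ ℝ) r hev
  have hs := hN.splits (AdjoinRoot.root f)
  rw [minpoly_root_quartic] at hs
  have hs' := hs.map (φ : AdjoinRoot f →+* ℝ)
  have hc : (φ : AdjoinRoot f →+* ℝ).comp (algebraMap ℚ (AdjoinRoot f)) = algebraMap ℚ ℝ :=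
    Subsingleton.elim _ _
  rw [Polynomial.map_map, hc, Polynomial.map_sub, Polynomial.map_pow, map_X,
    map_C, eq_ratCast, Rat.cast_ofNat] at hs'
  exact not_splits_X_pow_four_sub_two_real hs'

/-- `√2 := (⁴√2)²` is a root of `X ^ 2 - 2`. [folklore] -/
private theorem aeval_root_sq :
    aeval (AdjoinRoot.root (X ^ 4 - C (2 : ℚ) : ℚ[X]) ^ 2) (X ^ 2 - C (2 : ℚ) : ℚ[X]) = 0 := by
  rw [map_sub, map_pow, aeval_X, aeval_C, ← pow_mul, sub_eq_zero]
  exact root_pow_four.trans (map_ofNat _ 2).symm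

/-- `-⁴√2` is a root of `X ^ 4 - 2`. [folklore] -/
private theorem eval₂_neg_root :
    (X ^ 4 - C (2 : ℚ) : ℚ[X]).eval₂ (algebraMap ℚ (AdjoinRoot (X ^ 4 - C (2 : ℚ) : ℚ[X])))
      (-AdjoinRoot.root (X ^ 4 - C (2 : ℚ) : ℚ[X])) = 0 := by
  have h2 : (algebraMap ℚ (AdjoinRoot (X ^ 4 - C (2 : ℚ) : ℚ[X]))) 2 = 2 := map_ofNat _ 2
  rw [eval₂_sub, eval₂_X_pow, eval₂_C, neg_pow, root_pow_four, h2]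
  norm_num

/-- `⁴√2 ≠ 0` (as `(⁴√2) ^ 4 = 2 ≠ 0`). [folklore] -/
private theorem root_ne_zero : AdjoinRoot.root (X ^ 4 - C (2 : ℚ) : ℚ[X]) ≠ 0 := by
  intro h0
  have h4 := root_pow_four
  rw [h0, zero_pow four_ne_zero] at h4
  have h2 : (algebraMap ℚ (AdjoinRoot (X ^ 4 - C (2 : ℚ) : ℚ[X]))) 2 = 0 :=
    (map_ofNat _ 2).trans h4.symm
  rw [map_eq_zero_iff _ (algebraMap ℚ (AdjoinRoot (X ^ 4 - C (2 : ℚ) : ℚ[X]))).injective] at h2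
  norm_num at h2

end Quartic

end Thm62ivFieldDatum

open Thm62ivFieldDatum in
/-- **The field datum H_F1105' INHABITED.**  Some FINITE extension `Kt/K` — namely `ℚ(⁴√2)/ℚ`, `Kt := ℚ[X]/(X⁴ − 2)` —
has an automorphism `z ≠ 1` — namely the involution `z : ⁴√2 ↦ −⁴√2` — fixing pointwise every intermediate field that is
Galois over `K`: these all lie in `ℚ(√2)` (`ℚ(⁴√2)/ℚ` is not normal of degree `4`, `√2 = (⁴√2)²` has the irreducible
minimal polynomial `X² − 2`), and `z(√2) = √2`.  This is exactly the hypothesis of `not_forall_thm62iv_of_field`, i.e. the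
residual field datum of the typed row F-1105 (Thm. 6.2 (iv) WITHOUT print's standing hypothesis that `K̃/K` be Galois);
a classical example of elementary Galois theory, not a statement of the cited paper. [cite: MochizukiFrdI2008, Thm. 6.2 (iv) p.111] -/
theorem thm62iv_field_datum :
    ∃ (K Kt : Type) (_ : Field K) (_ : Field Kt) (_ : Algebra K Kt) (_ : FiniteDimensional K Kt)
      (z : Kt ≃ₐ[K] Kt), z ≠ 1 ∧ ∀ E : IntermediateField K Kt, IsGalois K E → ∀ x : Kt, x ∈ E → z x = x := by
  haveI : Fact (Irreducible (X ^ 4 - C (2 : ℚ) : ℚ[X])) := ⟨irreducible_X_pow_sub_two four_ne_zero⟩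
  haveI := finiteDimensional_quartic
  set f : ℚ[X] := X ^ 4 - C (2 : ℚ) with hf
  set α := AdjoinRoot.root f with hα
  -- the automorphism `α ↦ -α`: the lift of `-α` (a root of `f`), an involution
  obtain ⟨z, hzα⟩ : ∃ z : AdjoinRoot f ≃ₐ[ℚ] AdjoinRoot f, z α = -α := by
    let z₀ : AdjoinRoot f →ₐ[ℚ] AdjoinRoot f :=
      AdjoinRoot.liftAlgHom f (Algebra.ofId ℚ (AdjoinRoot f)) (-α) eval₂_neg_root
    have hz₀α : z₀ α = -α := AdjoinRoot.liftAlgHom_root f _ _ _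
    have hz₀z₀ : z₀.comp z₀ = AlgHom.id ℚ (AdjoinRoot f) := by
      apply AdjoinRoot.algHom_ext
      change z₀ (z₀ (AdjoinRoot.root f)) = AdjoinRoot.root f
      rw [← hα, hz₀α, map_neg, hz₀α, neg_neg]
    exact ⟨AlgEquiv.ofAlgHom z₀ z₀ hz₀z₀ hz₀z₀, hz₀α⟩
  refine ⟨ℚ, AdjoinRoot f, inferInstance, inferInstance, inferInstance, inferInstance, z,
    fun h1 => ?_, fun E hE x hx => ?_⟩
  · -- `z α = -α ≠ α` since `α ≠ 0`
    have hfix : z α = α := by rw [h1, AlgEquiv.one_apply]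
    rw [hzα, neg_eq_iff_add_eq_zero, ← two_smul ℚ α, smul_eq_zero] at hfix
    rcases hfix with h | h
    · norm_num at h
    · exact root_ne_zero h
  · haveI := hE
    exact trivial_on_galois_of_fixes_quadratic not_normal_quartic finrank_quartic
      (irreducible_X_pow_sub_two two_ne_zero) (monic_X_pow_sub_C (2 : ℚ) two_ne_zero)
      (natDegree_X_pow_sub_C (n := 2) (r := (2 : ℚ))) aeval_root_sq z
      (by rw [map_pow, hzα, neg_sq]) E x hx

/-- **F-1105 (`Thm62iv`) — the universal closure over the typed binders REFUTED, UNCONDITIONALLY.**  The row's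
declaration quantifies over ALL `K ⊆ K̃` (print's standing hypothesis of Ex. 6.1 p. 109, that `K̃/K` be Galois, is not
among the binders); at `K := ℚ`, `K̃ := ℚ(⁴√2)` and THE model `geomModelFrobenioid Γ` of the embedding divisor data
(`GeometricDivisorData.exists_pullPhi_faithful`) the third conjunct of `Thm62iv` fails: `D` is Div-slim but
`z : ⁴√2 ↦ −⁴√2` acts trivially on `Φ(L)` for every finite Galois `L` (`not_forall_thm62iv_of_field` applied to
`thm62iv_field_datum`).  Print's Thm. 6.2 (iv) (Galois `K̃/K`) is PROVED in the tree (`Thm62iv_holds`) and is untouched: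
refuted-as-typed ≠ refuted-in-print. [cite: MochizukiFrdI2008, Thm. 6.2 (iv) p.111] -/
theorem not_forall_thm62iv :
    ¬ ∀ (K : Type) (_ : Field K) (Kt : Type) (_ : Field Kt) (_ : Algebra K Kt) (Γ : GeometricDivisorData K Kt)
        (C : Type) (_ : Category.{0} C) (M : GeometricModelFrobenioid Γ C), Thm62iv M :=
  not_forall_thm62iv_of_field thm62iv_field_datum

end Literature.AlgebraicGeometry.Frobenioids

end
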